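import Summits.NavierStokesRegularity.NavierStokesRegularity.Theorems.StretchingWellBindingEnstrophyQuarterLawWeakTrace
import Summits.NavierStokesRegularity.NavierStokesRegularity.Theorems.TypeIQuarterGatePerSolutionTFAE
import Summits.NavierStokesRegularity.NavierStokesRegularity.Theorems.QuarterJoltEdgeLaw
import Summits.NavierStokesRegularity.NavierStokesRegularity.Theses.StretchingWellBinding
import Summits.NavierStokesRegularity.NavierStokesRegularity.Theses.TypeIQuarterGate
import HarnessLib

/-!
# Shelf 1574, line «weak_trace»: ASSEMBLY — the terminal slice of a quarter-law blow-up is weak-`L³`,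
# and on the Type-I stratum the Lorentz upgrade is a statement about the terminal slice alone

Companion (`--supports stmt-NavierStokesRegularity-1574 --as helper`) of
`Theorems/StretchingWellBindingEnstrophyQuarterLawWeakTrace.lean` (stubs 2–5 of the banked crux line
`Cruxes/EnstrophyQuarterLaw/Lines/weak_trace.lean`; stub 1 = `NoTerminalJolt.edgeLaw_lintegral`). With
all five stubs landed, the line's compositions are THEOREMS:

* `weakL3_terminal_of_sliceLaw` (per blow-up, NEW in the tree): along ONE maximal classical Leray–Hopf
  solution from a rapidly decaying datum, Leray's slice law `∫|curl u(t)|² ≤ K/√(T−t)` on `[0,T)` forces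
  `u(T) ∈ L^{3,∞}(ℝ³)` — the slice law gives the sup-norm Type-I rate (`RecordTimeTypeI`, item 22145),
  hence uniformly bounded weak-`L³` slices (`LorentzOfEnvelope.typeI_slice_tfae`: quarter law ⟹ count
  ⟹ Lorentz, per Type-I blow-up), the edge law `∫|u(s) − u(T)|² ≤ D√(T−s)`, and Fatou in `L^{3,∞}` along
  the strong `L²` convergence `u(s) → u(T)` (stub 5). Read with the landed `TraceTransfer`
  (`EnstrophyQuarterLaw → (NavierStokesRegularity ↔ L3Trace)`): on the shelf the terminal profile of a
  first blow-up is weak-`L³` but NOT locally `L³` at a singular point — an exactly critical `|x−x₀|⁻¹`-type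
  scar, no worse and no better.
* `weakL3Trace_of_enstrophyQuarterLaw` (BY NAME): `EnstrophyQuarterLaw → WeakL3Trace` (the line's «wuc»
  currency, unfolded verbatim).
* `lorentzBound_iff_weakL3_terminal_of_isTypeIBlowup_of_edge` (per Type-I blow-up, NON-degenerate): under
  the sup-norm Type-I rate and the terminal edge bound alone (no slice law), the conclusion of TIQG's open
  crux `LorentzUpgradeTypeI` (24108: bounded weak-`L³` slices on `[0,T)`) is EQUIVALENT to
  `u(T) ∈ L^{3,∞}`: levels above `max C 1/√(T−s)` are empty by the rate, levels below transfer from `u(T)`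
  through the edge bound (`WeakTrace.eWeakLpPow_three_le_of_edge_of_fast` with `C_f = 0`), early times
  are free (stub 4 `WeakTrace.stub_weakL3_early`); conversely stub 5.
* `lorentzUpgradeTypeI_iff_weakL3Trace_of_enstrophyQuarterLaw` — the line's headline
  `EnstrophyQuarterLaw → (LorentzUpgradeTypeI ↔ WeakL3Trace)`, now sorry-free; HONEST NOTE: since
  `LorentzUpgradeTypeI ↔ QuarterLawTypeI` is a tree theorem (`lorentzUpgradeTypeI_iff_quarterLawTypeI`)
  and `EnstrophyQuarterLaw → QuarterLawTypeI` trivially, BOTH sides hold on the shelf — the headline is a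
  degenerate equivalence there; its non-degenerate content is the per-Type-I-blow-up statement above.

HONEST FRAMING: conditional/shelf bookkeeping along HYPOTHETICAL blow-ups; `EnstrophyQuarterLaw` (1574),
`QuarterLawTypeI` (23726), `LorentzUpgradeTypeI` (24108) and NS regularity stay OPEN; no registered stub of
the skeleton of record `Lines/sparse_sieve.lean` is closed; nothing here proves a summit. [folklore]
-/

noncomputable section

-- the summit-side namespace repeats a component by design (D-0017)
set_option linter.dupNamespace false

namespace Summit.NavierStokesRegularity.NavierStokesRegularity.Theorems.EnstrophyQuarterLaw.WeakTrace

open Set MeasureTheory Function Metric Filter Topology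
open scoped ENNReal NNReal
open Literature.Analysis.FluidPDE Literature.Analysis.FunctionSpaces
open Summit.NavierStokesRegularity.NavierStokesRegularity.Theses.TypeIQuarterGate (LorentzUpgradeTypeI
  QuarterLawTypeI)

variable {ν T : ℝ} {u : ℝ → EuclideanSpace ℝ (Fin 3) → EuclideanSpace ℝ (Fin 3)}
  {p : ℝ → EuclideanSpace ℝ (Fin 3) → ℝ}

/-! ### The Type-I stratum: Lorentz bound ⟺ weak-`L³` terminal slice, given the edge bound -/

/-- **Type I + terminal edge bound + `u(T) ∈ L^{3,∞}` ⟹ bounded weak-`L³` slices on `[0,T)`.**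
For `(u, p)` classical on `[0,T)` (`ν, T > 0`), Leray–Hopf from its rapidly decaying datum, with the
sup-norm Type-I rate at `T` and the edge bound `∫|u(s) − u(T)|² ≤ D√(T−s)` on `[t₀,T)` (`0 ≤ t₀ < T`):
if `u(T) ∈ L^{3,∞}` then `sup_{[0,T)} ‖u(t)‖_{3,∞} < ∞` (the conclusion of `LorentzUpgradeTypeI` for this
solution). Levels above `max C 1/√(T−s)` are empty, levels below transfer from `u(T)`. [folklore] -/
theorem lorentzBound_of_weakL3_terminal_of_isTypeIBlowup_of_edge (hν : 0 < ν) (hT : 0 < T)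
    (hsol : IsClassicalNSSolutionOn (Ico 0 T) ν 0 u p) (hLH : IsLerayHopfOn T ν 0 (u 0) u)
    (hdec : HasRapidSpatialDecay (u 0)) (hI : IsTypeIBlowup u T) {D t₀ : ℝ} (ht₀ : 0 ≤ t₀)
    (ht₀T : t₀ < T)
    (hedge : ∀ s ∈ Ico t₀ T, ∫⁻ x, ‖u s x - u T x‖ₑ ^ 2 ≤ ENNReal.ofReal (D * Real.sqrt (T - s)))
    (hW : eWeakLpPow (u T) 3 volume < ⊤) :
    ∃ M' : ℝ, ∀ t ∈ Ico 0 T, eWeakLpPow (u t) 3 volume ≤ ENNReal.ofReal M' := by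
  obtain ⟨C, hC⟩ := hI
  obtain ⟨t₁, ht₁T, hsub⟩ := mem_nhdsLT_iff_exists_Ioo_subset.1 hC
  have ht₁T' : t₁ < T := ht₁T
  -- the weak-L³ size of the terminal slice
  set n : ℝ := (eWeakLpPow (u T) 3 volume).toReal with hn
  have hn0 : 0 ≤ n := ENNReal.toReal_nonneg
  have hz3 : eWeakLpPow (u T) 3 volume ≤ ENNReal.ofReal n := by
    rw [hn, ENNReal.ofReal_toReal hW.ne]
  have hz : AEStronglyMeasurable (u T) volume := (hLH.memLp T ⟨hT.le, le_rfl⟩).1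
  -- a final window inside both `(t₁, T)` and `[t₀, T)`
  set t₂ : ℝ := max t₀ ((t₁ + T) / 2) with ht₂
  have ht₂T : t₂ < T := max_lt ht₀T (by linarith [ht₁T'])
  set C' : ℝ := max C 1 with hC'
  have hC'pos : 0 < C' := lt_of_lt_of_le one_pos (le_max_right _ _)
  -- early times are free (stub 4); the late window `[t₂, T)` is the content
  obtain ⟨M₂, hM₂⟩ := stub_weakL3_early ν T hν hT u p hsol hLH hdec t₂ ht₂T
  suffices hlate : ∀ s ∈ Ico t₂ T,
      eWeakLpPow (u s) 3 volume ≤ ENNReal.ofReal (8 * n + 4 * (C' * max D 0)) by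
    refine ⟨max (8 * n + 4 * (C' * max D 0)) M₂, fun t ht => ?_⟩
    rcases lt_or_ge t t₂ with htt₂ | htt₂
    · exact (hM₂ t ⟨ht.1, htt₂.le⟩).trans (ENNReal.ofReal_le_ofReal (le_max_right _ _))
    · exact (hlate t ⟨htt₂, ht.2⟩).trans (ENNReal.ofReal_le_ofReal (le_max_left _ _))
  intro s hs
  have hst₀ : t₀ ≤ s := (le_max_left _ _).trans hs.1
  have hst₁ : t₁ < s :=
    lt_of_lt_of_le (by linarith [ht₁T'] : t₁ < (t₁ + T) / 2) ((le_max_right _ _).trans hs.1)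
  have hs0 : s ∈ Ico 0 T := ⟨ht₀.trans hst₀, hs.2⟩
  have hτ : 0 < T - s := sub_pos.2 hs.2
  have hsq : 0 < Real.sqrt (T - s) := Real.sqrt_pos.2 hτ
  have hrate : ∀ x, ‖u s x‖ ≤ C / Real.sqrt (T - s) := hsub ⟨hst₁, hs.2⟩
  have hv : AEStronglyMeasurable (u s) volume :=
    (hsol.contDiff_velocity hs0).continuous.aestronglyMeasurable
  -- threshold `Λ = C'/√(T−s)`: the levels above it are EMPTY
  have hΛ : 0 < C' / Real.sqrt (T - s) := div_pos hC'pos hsq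
  have hfast : ∀ σ : ℝ, C' / Real.sqrt (T - s) ≤ σ →
      ENNReal.ofReal (σ ^ 3) * volume {x | σ < ‖u s x‖} ≤ ENNReal.ofReal 0 := by
    intro σ hσ
    have hempty : {x | σ < ‖u s x‖} = ∅ := by
      refine eq_empty_of_forall_notMem fun x hx => ?_
      have h1 : ‖u s x‖ ≤ C' / Real.sqrt (T - s) :=
        (hrate x).trans (div_le_div_of_nonneg_right (le_max_left _ _) hsq.le)
      exact absurd (lt_of_lt_of_le hx (h1.trans hσ)) (lt_irrefl _)
    rw [hempty, measure_empty, mul_zero]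
    exact zero_le
  have hedge' : ∫⁻ x, ‖u s x - u T x‖ₑ ^ 2 ≤ ENNReal.ofReal (max D 0 * Real.sqrt (T - s)) :=
    (hedge s ⟨hst₀, hs.2⟩).trans (ENNReal.ofReal_le_ofReal
      (mul_le_mul_of_nonneg_right (le_max_left _ _) hsq.le))
  have key := eWeakLpPow_three_le_of_edge_of_fast hv hz hΛ (by positivity) le_rfl hn0 hedge' hfast hz3
  refine key.trans (ENNReal.ofReal_le_ofReal (le_of_eq ?_))
  have hne : Real.sqrt (T - s) ≠ 0 := hsq.ne'
  field_simp
  ring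

/-- **Terminal edge bound + bounded weak-`L³` slices ⟹ `u(T) ∈ L^{3,∞}`** (stub 5, repackaged with the
slice bound on all of `[0,T)`). [cite: Grafakos2014, Prop. 1.1.3] -/
theorem weakL3_terminal_of_lorentzBound_of_edge (hν : 0 < ν) (hT : 0 < T)
    (hsol : IsClassicalNSSolutionOn (Ico 0 T) ν 0 u p) (hLH : IsLerayHopfOn T ν 0 (u 0) u)
    {D t₀ : ℝ} (ht₀ : 0 ≤ t₀) (ht₀T : t₀ < T)
    (hedge : ∀ s ∈ Ico t₀ T, ∫⁻ x, ‖u s x - u T x‖ₑ ^ 2 ≤ ENNReal.ofReal (D * Real.sqrt (T - s)))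
    (hM : ∃ M' : ℝ, ∀ t ∈ Ico 0 T, eWeakLpPow (u t) 3 volume ≤ ENNReal.ofReal M') :
    eWeakLpPow (u T) 3 volume < ⊤ := by
  obtain ⟨M', hM'⟩ := hM
  exact stub_trace_of_slices ν T hν hT u p hsol hLH D t₀ ht₀T hedge
    ⟨M', fun s hs => hM' s ⟨ht₀.trans hs.1, hs.2⟩⟩

/-- **On the Type-I stratum, given the terminal edge bound, the Lorentz upgrade is a statement about the
terminal slice alone**: `(∃ M', ∀ t ∈ [0,T), ‖u(t)‖³_{3,∞} ≤ M') ↔ u(T) ∈ L^{3,∞}` — the NON-degenerate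
per-blow-up content of line «weak_trace» (no slice law assumed). [folklore] -/
theorem lorentzBound_iff_weakL3_terminal_of_isTypeIBlowup_of_edge (hν : 0 < ν) (hT : 0 < T)
    (hsol : IsClassicalNSSolutionOn (Ico 0 T) ν 0 u p) (hLH : IsLerayHopfOn T ν 0 (u 0) u)
    (hdec : HasRapidSpatialDecay (u 0)) (hI : IsTypeIBlowup u T) {D t₀ : ℝ} (ht₀ : 0 ≤ t₀)
    (ht₀T : t₀ < T)
    (hedge : ∀ s ∈ Ico t₀ T, ∫⁻ x, ‖u s x - u T x‖ₑ ^ 2 ≤ ENNReal.ofReal (D * Real.sqrt (T - s))) :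
    (∃ M' : ℝ, ∀ t ∈ Ico 0 T, eWeakLpPow (u t) 3 volume ≤ ENNReal.ofReal M') ↔
      eWeakLpPow (u T) 3 volume < ⊤ :=
  ⟨weakL3_terminal_of_lorentzBound_of_edge hν hT hsol hLH ht₀ ht₀T hedge,
    lorentzBound_of_weakL3_terminal_of_isTypeIBlowup_of_edge hν hT hsol hLH hdec hI ht₀ ht₀T hedge⟩

/-! ### The shelf, per blow-up: the slice law makes the terminal slice weak-`L³` -/

/-- **Leray's slice law along one first blow-up ⟹ `u(T) ∈ L^{3,∞}(ℝ³)`.** For a MAXIMAL classical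
Leray–Hopf solution from a rapidly decaying datum (`ν, T > 0`) with `∫|curl u(t)|² ≤ K/√(T−t)` on
`[0,T)`: Type I (`RecordTimeTypeI.main`), bounded weak-`L³` slices (`typeI_slice_tfae`, 1 ⟹ 2), the edge
law (`NoTerminalJolt.edgeLaw_lintegral`) and Fatou (`stub_trace_of_slices`). [folklore] -/
theorem weakL3_terminal_of_sliceLaw (hν : 0 < ν) (hT : 0 < T)
    (hmax : IsMaximalSmoothSolution ν 0 u p T) (hLH : IsLerayHopfOn T ν 0 (u 0) u)
    (hdec : HasRapidSpatialDecay (u 0)) {K : ℝ}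
    (hK : ∀ t ∈ Ico 0 T, ∫⁻ x, ‖curl (u t) x‖ₑ ^ 2 ≤ ENNReal.ofReal (K / Real.sqrt (T - t))) :
    eWeakLpPow (u T) 3 volume < ⊤ := by
  have hI : IsTypeIBlowup u T := RecordTimeTypeI.main hν hT hmax.1 hLH hdec K hK
  have h1 : ∃ K : ℝ, ∀ t ∈ Ico 0 T,
      ∫⁻ x, ‖curl (u t) x‖ₑ ^ 2 ≤ ENNReal.ofReal (K / Real.sqrt (T - t)) := ⟨K, hK⟩
  have hM : ∃ M' : ℝ, ∀ t ∈ Ico 0 T, eWeakLpPow (u t) 3 volume ≤ ENNReal.ofReal M' :=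
    ((LorentzOfEnvelope.typeI_slice_tfae (c₀ := 1 / 2) (by norm_num) (by norm_num) hν hT hmax hLH
      hdec hI).out 0 1).mp h1
  obtain ⟨D, t₀, ht₀, ht₀T, hD⟩ := NoTerminalJolt.edgeLaw_lintegral ν T hν hT u p hmax.1 hLH hdec K hK
  exact weakL3_terminal_of_lorentzBound_of_edge hν hT hmax.1 hLH ht₀ ht₀T hD hM

/-! ### By name -/

/-- **`EnstrophyQuarterLaw → WeakL3Trace`** (the line's «wuc» currency `WeakL3Trace` unfolded verbatim):
on the quarter-law shelf the terminal slice of every maximal classical Leray–Hopf solution from a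
rapidly decaying datum is in weak-`L³`. Conditional on the OPEN crux 1574; nothing is asserted about it.
[folklore] -/
theorem weakL3Trace_of_enstrophyQuarterLaw (hQ : Theses.StretchingWellBinding.EnstrophyQuarterLaw) :
    ∀ (ν T : ℝ), 0 < ν → 0 < T →
      ∀ (u : ℝ → EuclideanSpace ℝ (Fin 3) → EuclideanSpace ℝ (Fin 3)) (p : ℝ → EuclideanSpace ℝ (Fin 3) → ℝ),
        IsMaximalSmoothSolution ν 0 u p T → IsLerayHopfOn T ν 0 (u 0) u → HasRapidSpatialDecay (u 0) →
        eWeakLpPow (u T) 3 volume < ⊤ := by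
  intro ν T hν hT u p hmax hLH hdec
  obtain ⟨K, hK⟩ := hQ ν T hν hT u p hmax hLH hdec
  exact weakL3_terminal_of_sliceLaw hν hT hmax hLH hdec hK

/-- **`EnstrophyQuarterLaw → LorentzUpgradeTypeI`** (1574 ⟹ 24108, by name): the shelf crux restricted
to Type-I blow-ups is `QuarterLawTypeI` (23726), which is equivalent to `LorentzUpgradeTypeI` by the tree
theorem `lorentzUpgradeTypeI_iff_quarterLawTypeI`. [folklore] -/
theorem lorentzUpgradeTypeI_of_enstrophyQuarterLaw
    (hQ : Theses.StretchingWellBinding.EnstrophyQuarterLaw) : LorentzUpgradeTypeI :=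
  LorentzOfEnvelope.lorentzUpgradeTypeI_of_quarterLawTypeI
    fun ν T hν hT u p hmax hLH hdec _ => hQ ν T hν hT u p hmax hLH hdec

/-- **The line's headline `EnstrophyQuarterLaw → (LorentzUpgradeTypeI ↔ WeakL3Trace)`, sorry-free.**
HONEST NOTE: on the shelf BOTH sides hold (`lorentzUpgradeTypeI_of_enstrophyQuarterLaw`,
`weakL3Trace_of_enstrophyQuarterLaw`), so this equivalence is degenerate; the non-degenerate per-blow-up
statement is `lorentzBound_iff_weakL3_terminal_of_isTypeIBlowup_of_edge`. [folklore] -/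
theorem lorentzUpgradeTypeI_iff_weakL3Trace_of_enstrophyQuarterLaw
    (hQ : Theses.StretchingWellBinding.EnstrophyQuarterLaw) :
    LorentzUpgradeTypeI ↔
      ∀ (ν T : ℝ), 0 < ν → 0 < T →
        ∀ (u : ℝ → EuclideanSpace ℝ (Fin 3) → EuclideanSpace ℝ (Fin 3))
          (p : ℝ → EuclideanSpace ℝ (Fin 3) → ℝ),
          IsMaximalSmoothSolution ν 0 u p T → IsLerayHopfOn T ν 0 (u 0) u → HasRapidSpatialDecay (u 0) →
          eWeakLpPow (u T) 3 volume < ⊤ :=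
  ⟨fun _ => weakL3Trace_of_enstrophyQuarterLaw hQ, fun _ => lorentzUpgradeTypeI_of_enstrophyQuarterLaw hQ⟩

end Summit.NavierStokesRegularity.NavierStokesRegularity.Theorems.EnstrophyQuarterLaw.WeakTrace

end
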